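import Summits.KontsevichZagierPeriods.KontsevichZagierPeriods.Theorems.RootDecompZetaThreeFrontierWordMatchPreludeP1

/-! # `RootDecompZetaThreeFrontierWordMatchPreludeP2` — part 2/5 of the mechanical ≤360-line split of `MatchPrelude.stripped.lean`
(split by the decomp-kz census seat for landing; mathematics unchanged; part 2 continues part 1). -/

noncomputable section

namespace Summit.KontsevichZagierPeriods.RootDecompZetaThreeFrontier.WordLayer
open Set MeasureTheory
open Literature.NumberTheory.Transcendental

section GapForm

/-- **GAP FORM.**  Under the five order conditions of §23 the numerator is the restriction to `Σ g = 1` of a form `H` of degree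
`N` in the four gaps, every monomial `g^κ` of which satisfies the five conditions on its own. -/
theorem gap_form (p : MvPolynomial (Fin 3) ℚ) (β₀ β₁ γ₁ γ₂ α : ℕ)
    (h1 : ∀ e ∈ p.support, β₀ + β₁ + α ≤ e 0 + e 1 + e 2 + 2) (h2 : ∀ e ∈ p.support, β₁ ≤ e 1 + e 2 + 1)
    (h3 : ∀ e ∈ (duP3 p).support, γ₂ + γ₁ + α ≤ e 0 + e 1 + e 2 + 2) (h4 : ∀ e ∈ (duP3 p).support, γ₁ ≤ e 1 + e 2 + 1)
    (h5 : ∀ e ∈ (s01P p).support, α ≤ e 1 + e 2 + 1) :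
    ∃ (N : ℕ) (H : MvPolynomial (Fin 4) ℚ), H.IsHomogeneous N ∧
      (∀ t : Fin 3 → ℝ, MvPolynomial.aeval (gaps t) H = MvPolynomial.aeval t p) ∧
      ∀ κ ∈ H.support, β₀ + β₁ + α ≤ κ 1 + κ 2 + κ 3 + 2 ∧ β₁ ≤ κ 2 + κ 3 + 1 ∧ α ≤ κ 1 + κ 2 + 1 ∧
        γ₁ ≤ κ 0 + κ 1 + 1 ∧ γ₂ + γ₁ + α ≤ κ 0 + κ 1 + κ 2 + 2 := by
  set N : ℕ := max p.totalDegree (max (s01P p).totalDegree (duP3 p).totalDegree) with hN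
  have hN0 : p.totalDegree ≤ N := le_max_left _ _
  have hNτ : (s01P p).totalDegree ≤ N := (le_max_left _ _).trans (le_max_right _ _)
  have hNσ : (duP3 p).totalDegree ≤ N := (le_max_right _ _).trans (le_max_right _ _)
  have hH := isHomogeneous_homF isHomogeneous_gsub0 N p
  have hHτ := isHomogeneous_homF isHomogeneous_gsubτ N (s01P p)
  have hHσ := isHomogeneous_homF isHomogeneous_gsubσ N (duP3 p)
  have aH : ∀ t : Fin 3 → ℝ, MvPolynomial.aeval (gaps t) (homF gsub0 N p) = MvPolynomial.aeval t p := fun t => by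
    rw [aeval_gaps_homF gsub0 hN0, aeval_gaps_gsub0]
  have aHτ : ∀ t : Fin 3 → ℝ, MvPolynomial.aeval (gaps t) (homF gsubτ N (s01P p)) = MvPolynomial.aeval t p := fun t => by
    rw [aeval_gaps_homF gsubτ hNτ, aeval_gaps_gsubτ, aeval_s01P, s01_s01]
  have aHσ : ∀ t : Fin 3 → ℝ, MvPolynomial.aeval (gaps t) (homF gsubσ N (duP3 p)) = MvPolynomial.aeval t p := fun t => by
    rw [aeval_gaps_homF gsubσ hNσ, aeval_gaps_gsubσ, aeval_duP3, duΦ_duΦ]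
  have eτ : homF gsubτ N (s01P p) = homF gsub0 N p := eq_of_aeval_gaps_eq hHτ hH fun t => by rw [aHτ, aH]
  have eσ : homF gsubσ N (duP3 p) = homF gsub0 N p := eq_of_aeval_gaps_eq hHσ hH fun t => by rw [aHσ, aH]
  -- the five monomial-wise order conditions
  have g1 : GLow ![0, 1, 1, 1] (β₀ + β₁ + α - 2) (homF gsub0 N p) := by
    refine GLow.homF (a := ![1, 1, 1]) (fun i => ?_) (fun e he => ?_) N
    · fin_cases i
      · exact ((glow_X _ 1 (by simp)).add (glow_X _ 2 (by simp))).add (glow_X _ 3 (by simp))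
      · exact (glow_X _ 2 (by simp)).add (glow_X _ 3 (by simp))
      · exact glow_X _ 3 (by simp)
    · have := h1 e he
      simp [Fin.sum_univ_three]
      omega
  have g2 : GLow ![0, 0, 1, 1] (β₁ - 1) (homF gsub0 N p) := by
    refine GLow.homF (a := ![0, 1, 1]) (fun i => ?_) (fun e he => ?_) N
    · fin_cases i
      · exact glow_zero _ _
      · exact (glow_X _ 2 (by simp)).add (glow_X _ 3 (by simp))
      · exact glow_X _ 3 (by simp)
    · have := h2 e he
      simp [Fin.sum_univ_three]
      omega
  have g5 : GLow ![0, 1, 1, 0] (α - 1) (homF gsub0 N p) := by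
    rw [← eτ]
    refine GLow.homF (a := ![0, 1, 1]) (fun i => ?_) (fun e he => ?_) N
    · fin_cases i
      · exact glow_zero _ _
      · exact (glow_X _ 1 (by simp)).add (glow_X _ 2 (by simp))
      · exact glow_X _ 1 (by simp)
    · have := h5 e he
      simp [Fin.sum_univ_three]
      omega
  have g4 : GLow ![1, 1, 0, 0] (γ₁ - 1) (homF gsub0 N p) := by
    rw [← eσ]
    refine GLow.homF (a := ![0, 1, 1]) (fun i => ?_) (fun e he => ?_) N
    · fin_cases i
      · exact glow_zero _ _
      · exact (glow_X _ 0 (by simp)).add (glow_X _ 1 (by simp))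
      · exact glow_X _ 0 (by simp)
    · have := h4 e he
      simp [Fin.sum_univ_three]
      omega
  have g3 : GLow ![1, 1, 1, 0] (γ₂ + γ₁ + α - 2) (homF gsub0 N p) := by
    rw [← eσ]
    refine GLow.homF (a := ![1, 1, 1]) (fun i => ?_) (fun e he => ?_) N
    · fin_cases i
      · exact ((glow_X _ 0 (by simp)).add (glow_X _ 1 (by simp))).add (glow_X _ 2 (by simp))
      · exact (glow_X _ 0 (by simp)).add (glow_X _ 1 (by simp))
      · exact glow_X _ 0 (by simp)
    · have := h3 e he
      simp [Fin.sum_univ_three]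
      omega
  refine ⟨N, homF gsub0 N p, hH, aH, fun κ hκ => ?_⟩
  have c1 := g1 κ hκ
  have c2 := g2 κ hκ
  have c3 := g3 κ hκ
  have c4 := g4 κ hκ
  have c5 := g5 κ hκ
  simp [Fin.sum_univ_four] at c1 c2 c3 c4 c5
  omega

end GapForm

/-! ## Axiom audit (gen 11 second addendum, §24): the gap form — a deviation is an ERROR. -/

end Summit.KontsevichZagierPeriods.RootDecompZetaThreeFrontier.WordLayer

/-! ## §24f  the GAP FORM of an ordered reduced datum, BY NAME over the skeleton-local defs (tool for `stub_three_match`)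

Every `r` with `IsReducedOrdThree r` has integrand `H(g(t))/(t₀^β₀ t₁^β₁ (1-t₁)^γ₁ (1-t₂)^γ₂ (t₀-t₂)^α)` on `Δ₃` with `g(t) = (1-t₀, t₀-t₁, t₁-t₂, t₂)`
the gaps and `H ∈ ℚ[g₀,g₁,g₂,g₃]` a form of degree `N` EVERY MONOMIAL of which satisfies the five order conditions — i.e. `KZ.of r` is a
`ℚ`-combination of gap classes `[Δ₃, g^κ/((g₁+g₂+g₃)^β₀ (g₂+g₃)^β₁ (g₀+g₁)^γ₁ (g₀+g₁+g₂)^γ₂ (g₁+g₂)^α)]` with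
`β₀+β₁+α ≤ κ₁+κ₂+κ₃+2`, `β₁ ≤ κ₂+κ₃+1`, `α ≤ κ₁+κ₂+1`, `γ₁ ≤ κ₀+κ₁+1`, `γ₂+γ₁+α ≤ κ₀+κ₁+κ₂+2` (each separately convergent). -/

set_option linter.dupNamespace false

namespace Summit.KontsevichZagierPeriods.KontsevichZagierPeriods.Cruxes.GZNormalFormWThree.GZLadder

open Set MeasureTheory Literature.NumberTheory.Transcendental

-- `simplex` (verbatim skeleton spelling) is now supplied by the tree module `…Theorems.RootDecompZetaThreeFrontierGZLadderThreeWlog`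

/-- **the gap form of an ordered reduced datum** (`WordLayer.gap_form`) -/
theorem gapForm_of_isReducedOrdThree (r : KZ.IntegralRep 3) (h : IsReducedOrdThree r) :
    ∃ (β₀ β₁ γ₁ γ₂ α N : ℕ) (H : MvPolynomial (Fin 4) ℚ), H.IsHomogeneous N ∧
      (∀ κ ∈ H.support, β₀ + β₁ + α ≤ κ 1 + κ 2 + κ 3 + 2 ∧ β₁ ≤ κ 2 + κ 3 + 1 ∧ α ≤ κ 1 + κ 2 + 1 ∧
        γ₁ ≤ κ 0 + κ 1 + 1 ∧ γ₂ + γ₁ + α ≤ κ 0 + κ 1 + κ 2 + 2) ∧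
      r.domain = simplex 3 ∧
      EqOn r.integrand (fun t => MvPolynomial.aeval
          (Summit.KontsevichZagierPeriods.RootDecompZetaThreeFrontier.WordLayer.gaps t) H /
        (t 0 ^ β₀ * t 1 ^ β₁ * (1 - t 1) ^ γ₁ * (1 - t 2) ^ γ₂ * (t 0 - t 2) ^ α)) r.domain := by
  obtain ⟨hd, p, β₀, β₁, γ₁, γ₂, α, h1, h2, h3, h4, h5, hi⟩ := h
  obtain ⟨N, H, hH, haev, hκ⟩ :=
    Summit.KontsevichZagierPeriods.RootDecompZetaThreeFrontier.WordLayer.gap_form p β₀ β₁ γ₁ γ₂ α h1 h2 h3 h4 h5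
  exact ⟨β₀, β₁, γ₁, γ₂, α, N, H, hH, hκ, hd, fun t ht => by rw [hi ht]; simp only [haev]⟩

end Summit.KontsevichZagierPeriods.KontsevichZagierPeriods.Cruxes.GZNormalFormWThree.GZLadder

/-!
# decomp-kz lens-1 gen 11 — §25–§26 THE CONVERGENCE ENGINES: LAYER CLASSES and GENERAL GAP CLASSES (self-contained addendum to `WordLayer.lean`)

Crux chain: 28709 `GenusZeroThreeNormalForm` ⟸ 32433 `GZNormalFormWThree` ⟸ gz_ladder {…, stub_three_match (OPEN), stub_three_layer}.
MATCH (blueprint M0/M1 of `g11/NODE.md`) must WRITE a reduced datum as a ℚ-combination of LAYER classes modulo moves; to do so it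
must first PRODUCE the layer classes as honest `KZ.IntegralRep 3`s, i.e. prove that every layer integrand
`P/(t₀^β₀ t₁^β₁ (1-t₁)^γ₁ (1-t₂)^γ₂ (t₀-t₂)^α)` with `α, β₁, γ₁ ≤ 1`, `β₀+β₁+α ≤ 2`, `γ₂+γ₁+α ≤ 2` is ABSOLUTELY INTEGRABLE on `Δ₃`.
This file proves it (`layer_integrableOn`, `layerRep`, by name `GZLadder.isLayerThree_layerRep` / `GZLadder.of_layerRep_mem`) and, in §26,
the general engine `gapClass_integrableOn` / `gapRep` for the ADMISSIBLE GAP CLASSES delivered monomial-wise by the gap form (§24, `GapForm.lean`):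
* §25a the vertex chart `Ψ₃(y) = (y₂, y₂y₀, y₂y₀y₁)` of §23, CONVERSE direction (`integrableOn_of_vchart`: cube ⟹ `Δ₃`);
* §25b products of one-variable real powers `∏ (1-yᵢ)^{aᵢ}`, `aᵢ > -1`, are integrable on the cube (`Measure.restrict_pi_pi` +
  `Integrable.fintype_prod` + `intervalIntegrable_rpow'`);
* §25c the max/AM–GM bounds `1/(1-uv) ≤ (1-u)^{-a}(1-v)^{-b}` (`a+b=1`), `1/(1-uvw) ≤ (1-u)^{-a}(1-v)^{-b}(1-w)^{-c}` (`a+b+c=1`);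
* §25d the two MODEL MAJORANTS `M = 1/(t₀t₁(1-t₁)(1-t₂))` and `M_d = 1/(t₁(1-t₁)(t₀-t₂))` are integrable on `Δ₃`: in the chart
  `y₂²y₀·M∘Ψ₃ = 1/((1-y₂y₀)(1-y₂y₀y₁)) ≤ (1-y₀)^{-3/4}(1-y₁)^{-1/2}(1-y₂)^{-3/4}` and
  `y₂²y₀·M_d∘Ψ₃ = 1/((1-y₂y₀)(1-y₀y₁)) ≤ ∏(1-yᵢ)^{-2/3}`;
* §25e every inverse layer denominator is `≤ M + M_d` on `Δ₃` (the 8 maximal bare patterns `(α,β₁,γ₁) ∈ {0,1}³` are `≤ M` for `α = 0`,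
  `≤ M_d` for `α = 1`, by `t₁ ≤ t₀`, `1-t₁ ≤ 1-t₂`), `|P(t)| ≤ ‖P‖₁`, hence `|P/den| ≤ ‖P‖₁ (M + M_d)` and `layer_integrableOn`;
  `layerF_sa` (quotient of polynomials) and the constructor `layerRep : KZ.IntegralRep 3`.
* §26 THE GENERAL CONVERGENCE ENGINE (sector criterion, sufficiency): `gapClass_integrableOn` — under the FIVE order conditions of §23/§24
  (V0 `β₀+β₁+α ≤ κ₁+κ₂+κ₃+2`, E1 `β₁ ≤ κ₂+κ₃+1`, Ed `α ≤ κ₁+κ₂+1`, E2 `γ₁ ≤ κ₀+κ₁+1`, V1 `γ₂+γ₁+α ≤ κ₀+κ₁+κ₂+2`) the GAP CLASS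
  `gapF κ β₀ β₁ γ₁ γ₂ α = g^κ/((123)^β₀ (23)^β₁ (01)^γ₁ (012)^γ₂ (12)^α)`, `g = (1-t₀, t₀-t₁, t₁-t₂, t₂)`, is absolutely integrable on `Δ₃`;
  `gapF_sa`, constructor `gapRep : KZ.IntegralRep 3`.  Proof: LOCALISE by the vertex chart — `y₂^{β₀+β₁+α} y₀^{β₁}·(y₂²y₀·gapF∘Ψ₃) =
  y₂^{κ₁₂₃+2} y₀^{κ₂₃+1}·gapW` (`gapF_chart_mul`, so V0/E1 give `y₂²y₀·gapF∘Ψ₃ ≤ gapW`), then ROUTE the far-corner factors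
  `(1-y₀y₁)^{-α}`, `(1-y₂y₀)^{-γ₁}`, `(1-y₂y₀y₁)^{-γ₂}` of `gapW` onto `(1-y₀)^{κ₁}`, `(1-y₁)^{κ₂}`, `(1-y₂)^{κ₀}` by max/AM–GM with REAL
  weights (`one_div_pow_le_rpow2/3`, `gapW_le`): a 3-source transportation problem whose Hall conditions are exactly Ed, E2, V1, solved
  greedily in `routing3` (saturate the sinks `1-y₁`, `1-y₂` up to `κ+3/4`, the universal sink `1-y₀` takes the rest).  CAVEAT recorded in
  NODE.md: WITHOUT the localisation per-factor AM–GM is NOT sufficient (`g₁²g₂²/((123)⁶(012)⁶)`).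
§25·0 = verbatim copies of §21a/§23a prerequisites (drop when splicing `part_s25.lean`/`part_s26.lean` after §23).
Standard axioms only (audit at the end); farm `lean check`: rc 0, 0 errors, 0 warnings, 0 sorries.
-/

noncomputable section

set_option linter.dupNamespace false

open Set MeasureTheory MvPolynomial
open Literature.NumberTheory.Transcendental
open Summit.KontsevichZagierPeriods.KontsevichZagierPeriods.Theorems.RootDecompZetaThreeFrontierWordMoves (mem_simplex_three_iff)

namespace Summit.KontsevichZagierPeriods.RootDecompZetaThreeFrontier.WordLayer

section LayerConvPrereqs

/-! ### 25·0  Prerequisites (verbatim copies of §21a/§22/§23a of the node file) -/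

/-- Auxiliary step `continuous_aeval_fin`. [bookkeeping] -/
private theorem continuous_aeval_fin {n : ℕ} (p : MvPolynomial (Fin n) ℚ) :
    Continuous fun x : Fin n → ℝ => MvPolynomial.aeval x p := by
  have : (fun x : Fin n → ℝ => MvPolynomial.aeval x p) =
      fun x => MvPolynomial.eval x (MvPolynomial.map (algebraMap ℚ ℝ) p) := by
    funext x; rw [MvPolynomial.eval_map, MvPolynomial.aeval_def]
  rw [this]
  exact MvPolynomial.continuous_eval _

/-- `simplex` is measurable. [bookkeeping] -/
private theorem measurableSet_simplex (k : ℕ) : MeasurableSet (KZ.openOrderedSimplex k) :=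
  Literature.ModelTheory.ExponentialFields.IsSemialgebraic.measurableSet_holds (KZ.isSemialgebraic_openOrderedSimplex k)

/-- Auxiliary step `aeval_eq_sum_three`. [bookkeeping] -/
private theorem aeval_eq_sum_three (p : MvPolynomial (Fin 3) ℚ) (t : Fin 3 → ℝ) :
    MvPolynomial.aeval t p =
      ∑ m ∈ p.support, ((MvPolynomial.coeff m p : ℚ) : ℝ) * (t 0 ^ (m 0) * t 1 ^ (m 1) * t 2 ^ (m 2)) := by
  rw [MvPolynomial.aeval_def, MvPolynomial.eval₂_eq']
  refine Finset.sum_congr rfl fun m _ => ?_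
  simp [Fin.prod_univ_three, eq_ratCast]

/-- Auxiliary step `Pj3`. [bookkeeping] -/
abbrev Pj3 (i : Fin 3) : (Fin 3 → ℝ) →L[ℝ] ℝ := ContinuousLinearMap.proj (R := ℝ) (φ := fun _ : Fin 3 => ℝ) i

/-- the open unit cube `(0,1)³` -/
def Cube3 : Set (Fin 3 → ℝ) := {y | 0 < y 0 ∧ y 0 < 1 ∧ 0 < y 1 ∧ y 1 < 1 ∧ 0 < y 2 ∧ y 2 < 1}

/-- Auxiliary step `isOpen_Cube3`. [bookkeeping] -/
theorem isOpen_Cube3 : IsOpen Cube3 := by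
  have h0 : Continuous fun y : Fin 3 → ℝ => y 0 := continuous_apply 0
  have h1 : Continuous fun y : Fin 3 → ℝ => y 1 := continuous_apply 1
  have h2 : Continuous fun y : Fin 3 → ℝ => y 2 := continuous_apply 2
  simp only [Cube3, Set.setOf_and]
  exact (isOpen_lt continuous_const h0).inter ((isOpen_lt h0 continuous_const).inter
    ((isOpen_lt continuous_const h1).inter ((isOpen_lt h1 continuous_const).inter
    ((isOpen_lt continuous_const h2).inter (isOpen_lt h2 continuous_const)))))

/-- `Cube3` is measurable. [bookkeeping] -/
theorem measurableSet_Cube3 : MeasurableSet Cube3 := isOpen_Cube3.measurableSet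

/-- the VERTEX CHART `Ψ₃(y) = (y₂, y₂·y₀, y₂·y₀·y₁)`: the open cube onto `Δ₃`, the face `y₂ = 0` onto the vertex `(0,0,0)` -/
def vΨ (y : Fin 3 → ℝ) : Fin 3 → ℝ := ![y 2, y 2 * y 0, y 2 * y 0 * y 1]

/-- Auxiliary step `vΨ_zero`. [bookkeeping] -/
theorem vΨ_zero (y : Fin 3 → ℝ) : vΨ y 0 = y 2 := by simp [vΨ]
/-- Auxiliary step `vΨ_one`. [bookkeeping] -/
theorem vΨ_one (y : Fin 3 → ℝ) : vΨ y 1 = y 2 * y 0 := by simp [vΨ]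
/-- Auxiliary step `vΨ_two`. [bookkeeping] -/
theorem vΨ_two (y : Fin 3 → ℝ) : vΨ y 2 = y 2 * y 0 * y 1 := by simp [vΨ]

/-- the rows of `DΨ₃(y)` -/
def vRow (y : Fin 3 → ℝ) : Fin 3 → ((Fin 3 → ℝ) →L[ℝ] ℝ) :=
  ![Pj3 2, y 2 • Pj3 0 + y 0 • Pj3 2, (y 2 * y 0) • Pj3 1 + y 1 • (y 2 • Pj3 0 + y 0 • Pj3 2)]

/-- `DΨ₃(y)` -/
def vL (y : Fin 3 → ℝ) : (Fin 3 → ℝ) →L[ℝ] (Fin 3 → ℝ) := ContinuousLinearMap.pi (vRow y)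

/-- Auxiliary step `vL_apply_zero`. [bookkeeping] -/
theorem vL_apply_zero (y h : Fin 3 → ℝ) : vL y h 0 = h 2 := by simp [vL, vRow]
/-- Auxiliary step `vL_apply_one`. [bookkeeping] -/
theorem vL_apply_one (y h : Fin 3 → ℝ) : vL y h 1 = y 2 * h 0 + y 0 * h 2 := by simp [vL, vRow]
/-- Auxiliary step `vL_apply_two`. [bookkeeping] -/
theorem vL_apply_two (y h : Fin 3 → ℝ) : vL y h 2 = y 2 * y 0 * h 1 + y 1 * (y 2 * h 0 + y 0 * h 2) := by
  simp [vL, vRow]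
  ring

/-- Auxiliary step `hasFDerivAt_vΨ`. [bookkeeping] -/
theorem hasFDerivAt_vΨ (y : Fin 3 → ℝ) : HasFDerivAt vΨ (vL y) y := by
  have h0 : HasFDerivAt (fun q : Fin 3 → ℝ => q 0) (Pj3 0) y := hasFDerivAt_apply (𝕜 := ℝ) 0 y
  have h1 : HasFDerivAt (fun q : Fin 3 → ℝ => q 1) (Pj3 1) y := hasFDerivAt_apply (𝕜 := ℝ) 1 y
  have h2 : HasFDerivAt (fun q : Fin 3 → ℝ => q 2) (Pj3 2) y := hasFDerivAt_apply (𝕜 := ℝ) 2 y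
  have c1 : HasFDerivAt (fun q : Fin 3 → ℝ => q 2 * q 0) (y 2 • Pj3 0 + y 0 • Pj3 2) y := h2.mul h0
  have c2 : HasFDerivAt (fun q : Fin 3 → ℝ => q 2 * q 0 * q 1)
      ((y 2 * y 0) • Pj3 1 + y 1 • (y 2 • Pj3 0 + y 0 • Pj3 2)) y := c1.mul h1
  have key : HasFDerivAt (fun q : Fin 3 → ℝ => fun i => (![q 2, q 2 * q 0, q 2 * q 0 * q 1] : Fin 3 → ℝ) i)
      (ContinuousLinearMap.pi (vRow y)) y := by
    refine hasFDerivAt_pi.2 fun i => ?_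
    fin_cases i
    · simpa [vRow] using h2
    · simpa [vRow] using c1
    · simpa [vRow] using c2
  exact key

/-- the Jacobian matrix of `Ψ₃` -/
def vM (y : Fin 3 → ℝ) : Matrix (Fin 3) (Fin 3) ℝ := !![0, 0, 1; y 2, 0, y 0; y 1 * y 2, y 2 * y 0, y 1 * y 0]

/-- Auxiliary step `vL_eq_toLin'`. [bookkeeping] -/
theorem vL_eq_toLin' (y : Fin 3 → ℝ) :
    (vL y : (Fin 3 → ℝ) →ₗ[ℝ] (Fin 3 → ℝ)) = Matrix.toLin' (vM y) := by
  apply LinearMap.ext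
  intro h
  rw [Matrix.toLin'_apply, ContinuousLinearMap.coe_coe]
  funext i
  fin_cases i
  · simp [vL_apply_zero, vM, Matrix.mulVec, dotProduct, Fin.sum_univ_three]
  · simp [vL_apply_one, vM, Matrix.mulVec, dotProduct, Fin.sum_univ_three]
  · simp [vL_apply_two, vM, Matrix.mulVec, dotProduct, Fin.sum_univ_three]
    ring

/-- Auxiliary step `det_vL`. [bookkeeping] -/
theorem det_vL (y : Fin 3 → ℝ) : (vL y).det = y 2 ^ 2 * y 0 := by
  show LinearMap.det (vL y : (Fin 3 → ℝ) →ₗ[ℝ] (Fin 3 → ℝ)) = _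
  rw [vL_eq_toLin', LinearMap.det_toLin', vM, Matrix.det_fin_three]
  simp
  ring

/-- Auxiliary step `vΨ_mem`. [bookkeeping] -/
theorem vΨ_mem {y : Fin 3 → ℝ} (hy : y ∈ Cube3) : vΨ y ∈ KZ.openOrderedSimplex 3 := by
  obtain ⟨h0, h01, h1, h11, h2, h21⟩ := hy
  rw [mem_simplex_three_iff, vΨ_zero, vΨ_one, vΨ_two]
  have h20 : 0 < y 2 * y 0 := mul_pos h2 h0
  exact ⟨mul_pos h20 h1, by nlinarith, by nlinarith, h21⟩

/-- Auxiliary step `injOn_vΨ`. [bookkeeping] -/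
theorem injOn_vΨ : InjOn vΨ Cube3 := by
  intro y hy y' hy' h
  have e2 : y 2 = y' 2 := by
    have := congrFun h 0
    rwa [vΨ_zero, vΨ_zero] at this
  have e0 : y 0 = y' 0 := by
    have := congrFun h 1
    rw [vΨ_one, vΨ_one, ← e2] at this
    exact mul_left_cancel₀ hy.2.2.2.2.1.ne' this
  have e1 : y 1 = y' 1 := by
    have := congrFun h 2
    rw [vΨ_two, vΨ_two, ← e2, ← e0] at this
    exact mul_left_cancel₀ (mul_pos hy.2.2.2.2.1 hy.1).ne' this
  funext i
  fin_cases i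
  · exact e0
  · exact e1
  · exact e2

/-- Auxiliary step `image_vΨ`. [bookkeeping] -/
theorem image_vΨ : vΨ '' Cube3 = KZ.openOrderedSimplex 3 := by
  ext t
  constructor
  · rintro ⟨y, hy, rfl⟩
    exact vΨ_mem hy
  · intro ht
    obtain ⟨h2, h21, h10, h0⟩ := (mem_simplex_three_iff t).1 ht
    have ht1 : 0 < t 1 := h2.trans h21
    have ht0 : 0 < t 0 := ht1.trans h10
    have ht0' : t 0 ≠ 0 := ht0.ne'
    have ht1' : t 1 ≠ 0 := ht1.ne'
    refine ⟨![t 1 / t 0, t 2 / t 1, t 0], ?_, ?_⟩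
    · simp only [Cube3, mem_setOf_eq, Matrix.cons_val_zero, Matrix.cons_val_one, Matrix.head_cons, Matrix.cons_val_two,
        Matrix.tail_cons]
      exact ⟨by positivity, by rwa [div_lt_one ht0], by positivity, by rwa [div_lt_one ht1], ht0, h0⟩
    · funext i
      fin_cases i <;> simp [vΨ] <;> field_simp

end LayerConvPrereqs

section LayerConv

/-! ### 25a  The vertex chart, converse direction: integrability on the cube gives integrability on `Δ₃` -/

/-- **the vertex blow-up push-forward**: `y ↦ y₂²y₀·F(Ψ₃ y)` integrable on the cube ⟹ `F` integrable on `Δ₃` -/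
theorem integrableOn_of_vchart {F : (Fin 3 → ℝ) → ℝ} (hF : IntegrableOn (fun y => y 2 ^ 2 * y 0 * F (vΨ y)) Cube3) :
    IntegrableOn F (KZ.openOrderedSimplex 3) := by
  rw [← image_vΨ]
  refine (integrableOn_image_iff_integrableOn_abs_det_fderiv_smul (μ := volume) measurableSet_Cube3
    (fun y _ => (hasFDerivAt_vΨ y).hasFDerivWithinAt) injOn_vΨ F).2 ?_
  refine hF.congr_fun (fun y hy => ?_) measurableSet_Cube3
  have hy0 := hy.1
  have hy2 := hy.2.2.2.2.1
  show y 2 ^ 2 * y 0 * F (vΨ y) = |(vL y).det| • F (vΨ y)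
  rw [det_vL, abs_of_pos (by positivity), smul_eq_mul]

/-! ### 25b  Products of one-variable powers on the cube -/

/-- Auxiliary step `Cube3_eq_pi`. [bookkeeping] -/
theorem Cube3_eq_pi : Cube3 = Set.univ.pi (fun _ : Fin 3 => Ioo (0:ℝ) 1) := by
  ext y
  simp only [Cube3, mem_setOf_eq, mem_univ_pi, mem_Ioo]
  refine ⟨fun h i => ?_, fun h => ⟨(h 0).1, (h 0).2, (h 1).1, (h 1).2, (h 2).1, (h 2).2⟩⟩
  obtain ⟨h0, h01, h1, h11, h2, h21⟩ := h
  fin_cases i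
  · exact ⟨h0, h01⟩
  · exact ⟨h1, h11⟩
  · exact ⟨h2, h21⟩

end LayerConv
end Summit.KontsevichZagierPeriods.RootDecompZetaThreeFrontier.WordLayer
end
end
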